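import Summits.Ventures.PercRepro.C041MultiExitMain

/-!
# ROW C-041 — TWO COROLLARIES OF THEOREM (BLOCK MAP, `r` EXITS): the anchor product of a family of zones, and
`r` zones hung at ONE vertex (p6, gen 33; mine-3's C-041.md §20 (b)(3) «`Π` is multiplicative over the blocks at
the anchor», §20 (c))

Setting of `C041MultiExitMain`.  (1) THE ANCHOR PRODUCT: the host reduced to one vertex (`vertexHost`, no edges),
every zone hung at it — the family glued at one anchor in one step (the `Σ`-typed form of `C041GlueFold`'s
`foldGlue`); its six-vector is the product of the zones' six-vectors (`sixVec_hang_vertex`: one colouring, every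
exit merged and reached, no block).  (2) COINCIDENT EXITS: every exit at the same vertex `v` of an arbitrary host
`Z₁`; under a colouring `ω` either every exit is merged or every exit is separated in ONE block, so the block map
collapses to the one-exit block map evaluated at the product of the six-vectors (`sixVec_hang_const`,
`merged_const`, `blocks_const`; `exitOf` distributes over products, `exitOf_prod`), and hence
**hanging a family of zones at one vertex is hanging their anchor product there** (`sixVec_hang_const_eq`: the
six-vector of `hang Z₁ (fun _ => v) Z a` is that of the one-zone attachment of `hang vertexHost … Z a` at `v`).
-/

namespace PercRepro

namespace ZoneZ

namespace MultiExit

open ZoneData Pendant Finset TwoExit TreeClosure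

/-! ## `θ_B` and `exitOf` on products -/

/-- `θ_B` is multiplicative over finite products. -/
theorem thB_prod {κ : Type} (s : Finset κ) (w : κ → Vec6) : thB (∏ k ∈ s, w k) = ∏ k ∈ s, thB (w k) := by
  funext i
  fin_cases i <;> simp [thB, Finset.prod_apply]

/-- `exitOf` distributes over finite products (for one reached-status). -/
theorem exitOf_prod {κ : Type} (s : Finset κ) (w : κ → Vec6) (r : Prop) :
    exitOf (∏ k ∈ s, w k) r = ∏ k ∈ s, exitOf (w k) r := by
  classical
  unfold exitOf
  by_cases hr : r
  · simp only [hr, if_true]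
  · simp only [hr, if_false]
    exact thB_prod s w

/-! ## The statuses on the one-vertex host and with coincident exits -/

/-- The one-vertex unmarked host: one vertex, no edges. -/
def vertexHost : ZoneData Unit Empty Empty Empty := ⟨Empty.elim, Empty.elim, Empty.elim, Empty.elim⟩

variable {ι : Type} [Fintype ι]

/-- On the one-vertex host every exit is merged. -/
theorem merged_vertexHost (ω : Empty → Bool) : merged vertexHost (fun _ : ι => ()) () ω = univ := by
  rw [Finset.eq_univ_iff_forall]
  intro k
  rw [mem_merged]
  exact Mg_refl vertexHost ω ()

/-- On the one-vertex host there is no block. -/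
theorem blocks_vertexHost (ω : Empty → Bool) : blocks vertexHost (fun _ : ι => ()) () ω = ∅ := by
  rw [Finset.eq_empty_iff_forall_notMem]
  intro B hB
  obtain ⟨k, hk, -⟩ := (mem_blocks vertexHost (fun _ : ι => ()) () ω B).1 hB
  exact hk (Mg_refl vertexHost ω ())

variable {V₁ E₁ U₁ U₂ : Type} (Z₁ : ZoneData V₁ E₁ U₁ U₂) (v a₁ : V₁)

open Classical in
/-- With every exit at `v`: the merged exits are all or none. -/
theorem merged_const (ω : E₁ → Bool) :
    merged Z₁ (fun _ : ι => v) a₁ ω = if Z₁.Mg a₁ v ω then univ else ∅ := by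
  ext k
  rw [mem_merged]
  split_ifs with h <;> simp [h]

open Classical in
/-- With every exit at `v` (and at least one exit): no block if `v` is merged, one block of all the exits if not. -/
theorem blocks_const [Nonempty ι] (ω : E₁ → Bool) :
    blocks Z₁ (fun _ : ι => v) a₁ ω = if Z₁.Mg a₁ v ω then ∅ else {univ} := by
  split_ifs with h
  · rw [Finset.eq_empty_iff_forall_notMem]
    intro B hB
    obtain ⟨k, hk, -⟩ := (mem_blocks Z₁ (fun _ : ι => v) a₁ ω B).1 hB
    exact hk h
  · have e2 : ∀ k : ι, blk Z₁ (fun _ : ι => v) a₁ ω k = univ := by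
      intro k
      rw [Finset.eq_univ_iff_forall]
      intro l
      rw [mem_blk]
      exact ⟨h, Mg_refl Z₁ ω v⟩
    ext B
    rw [mem_blocks, Finset.mem_singleton]
    constructor
    · rintro ⟨k, -, rfl⟩
      exact e2 k
    · rintro rfl
      exact ⟨Classical.arbitrary ι, h, e2 _⟩

/-! ## The anchor product of a family, and coincident exits -/

variable {V E T₁ T₂ : ι → Type} (Z : (k : ι) → ZoneData (V k) (E k) (T₁ k) (T₂ k)) (a : (k : ι) → V k)
variable [DecidableEq ι] [∀ k, Fintype (E k)] [∀ k, DecidableEq (E k)] [∀ k, Fintype (T₁ k)]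
  [∀ k, DecidableEq (T₁ k)] [∀ k, Fintype (T₂ k)] [∀ k, DecidableEq (T₂ k)]

/-- **THE ANCHOR PRODUCT**: the six-vector of a family of zones glued at one anchor is the product of their
six-vectors. -/
theorem sixVec_hang_vertex :
    (hang vertexHost (fun _ : ι => ()) Z a).sixVec (Sum.inl ()) = ∏ k, (Z k).sixVec (a k) := by
  rw [sixVec_hang, Fintype.sum_unique]
  simp only [merged_vertexHost, blocks_vertexHost, Finset.prod_empty, mul_one]
  refine Finset.prod_congr rfl fun k _ => ?_
  have hr : ∀ ω : Empty → Bool, vertexHost.Rd () () ω := fun _ => mem_reach_of_mem rfl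
  unfold exitOf
  rw [if_pos (hr _)]

variable [Fintype E₁] [DecidableEq E₁]

open Classical in
/-- **COINCIDENT EXITS**: the six-vector of a family of zones hung at one vertex `v` is the one-exit block map of
the host at `v`, evaluated at the product of the six-vectors. -/
theorem sixVec_hang_const [Nonempty ι] :
    (hang Z₁ (fun _ : ι => v) Z a).sixVec (Sum.inl a₁) = ∑ ω : E₁ → Bool,
      if Z₁.Mg a₁ v ω then exitOf (∏ k, (Z k).sixVec (a k)) (Z₁.Rd a₁ v ω)
        else thR (exitOf (∏ k, (Z k).sixVec (a k)) (Z₁.Rd a₁ v ω)) := by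
  rw [sixVec_hang]
  refine Finset.sum_congr rfl fun ω _ => ?_
  rw [merged_const, blocks_const, exitOf_prod]
  split_ifs with h
  · rw [Finset.prod_empty, mul_one]
  · rw [Finset.prod_empty, one_mul, Finset.prod_singleton]

/-- **Hanging a family at one vertex is hanging its anchor product there**: the six-vector of `hang Z₁ (fun _ => v)
Z a` at `a₁` is that of the one-zone attachment at `v` of the anchor product `hang vertexHost … Z a`. -/
theorem sixVec_hang_const_eq [Nonempty ι] :
    (hang Z₁ (fun _ : ι => v) Z a).sixVec (Sum.inl a₁) =
      (hang Z₁ (fun _ : Unit => v) (fun _ => hang vertexHost (fun _ : ι => ()) Z a) (fun _ => Sum.inl ())).sixVec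
        (Sum.inl a₁) := by
  rw [sixVec_hang_const, sixVec_hang_const (ι := Unit)]
  refine Finset.sum_congr rfl fun ω _ => ?_
  rw [Fintype.prod_unique (fun _ : Unit => (hang vertexHost (fun _ : ι => ()) Z a).sixVec (Sum.inl ())),
    sixVec_hang_vertex]

end MultiExit

end ZoneZ

end PercRepro
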